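import Summits.Ventures.DiscreteObjects.Hadamard.ElemAbelianAction

/-!
# Hadamard 668 census, family F12 — lines of `(ℤ/p)²`: punctured lines, generation by two independent elements, and the
# line partition of the Burnside sum (kernel tools, general prime `p`)

Framing: lottery ticket; floor = certified bounds/negative ranges.

Cell pub-namedobj (venture DiscreteObjects), target (H), hadamard gen 16.  General-`p` versions of the `(ℤ/23)²` tools of
`ElemAbelian23Count` / `ElemAbelian23Stab`, for the group `Multiplicative (ZMod p × ZMod p)`:
* `eq_one_of_pow_eq_one_prime` (`g^m = 1`, `0 < m < p` ⇒ `g = 1`), punctured lines `{g^(k+1) : k < p-1}`: membership,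
  cardinality `p − 1`, `1 ∉`, disjointness (`mem_pline_iff`, `card_pline`, `one_not_mem_pline`, `disjoint_plines`);
* **generation** (`exists_pow_mul_pow`): if `g ≠ 1` and `h ≠ 1` is not on the line of `g`, every element is `g^a h^b`
  (`a, b < p`) — Lagrange: the subgroup of such products has more than `p` elements;
* **line representatives** `ofAdd (1, t)` (`t ∈ ℤ/p`) and `ofAdd (0, 1)`: every `x ≠ 1` lies on exactly one of their lines,
  and for a function constant on punctured lines `Σ_{x ≠ 1} F x = (p−1) · Σ_{reps} F r` (`sum_erase_one_eq_lines`).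
Used by `ElemAbelianRank2_11`.  Ours; no `sorry`.
-/

namespace Summit.Ventures.DiscreteObjects.Hadamard

open Finset BigOperators

section lines
variable (p : ℕ) [hp : Fact p.Prime]

/-- in `(ℤ/p)²`: `g^m = 1` with `0 < m < p` forces `g = 1` -/
lemma eq_one_of_pow_eq_one_prime {g : Multiplicative (ZMod p × ZMod p)} {m : ℕ} (hm0 : 0 < m) (hm : m < p)
    (h : g ^ m = 1) : g = 1 := by
  have hcop : Nat.Coprime m p :=
    Nat.Coprime.symm ((Nat.Prime.coprime_iff_not_dvd hp.out).2
      (fun h => absurd (Nat.le_of_dvd hm0 h) (not_le.2 hm)))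
  obtain ⟨u, -, hu⟩ := Nat.exists_mul_mod_eq_one_of_coprime hcop hp.out.one_lt
  have hgp : g ^ p = 1 := pair_pow_p p g
  calc g = g ^ ((m * u) % p) := by rw [hu, pow_one]
    _ = g ^ (m * u) := (pow_eq_pow_mod _ hgp).symm
    _ = 1 := by rw [pow_mul, h, one_pow]

/-- membership in a punctured line -/
lemma mem_pline_iff (g h : Multiplicative (ZMod p × ZMod p)) :
    h ∈ (Finset.range (p - 1)).image (fun k => g ^ (k + 1)) ↔ ∃ k, k < p - 1 ∧ h = g ^ (k + 1) := by
  simp only [Finset.mem_image, Finset.mem_range]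
  constructor
  · rintro ⟨k, hk, rfl⟩; exact ⟨k, hk, rfl⟩
  · rintro ⟨k, hk, rfl⟩; exact ⟨k, hk, rfl⟩

/-- a punctured line of `g ≠ 1` has `p − 1` elements -/
lemma card_pline {g : Multiplicative (ZMod p × ZMod p)} (hg : g ≠ 1) :
    ((Finset.range (p - 1)).image (fun k => g ^ (k + 1))).card = p - 1 := by
  rw [Finset.card_image_of_injOn, Finset.card_range]
  intro k hk l hl hkl
  simp only [Finset.coe_range, Set.mem_Iio] at hk hl
  simp only at hkl
  by_contra hne
  rcases Nat.lt_or_gt_of_ne hne with hlt | hlt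
  · have : g ^ (l - k) = 1 := by
      have e : g ^ (l + 1) = g ^ (k + 1) * g ^ (l - k) := by rw [← pow_add]; congr 1; omega
      rw [← hkl] at e
      exact (mul_eq_left.mp e.symm)
    exact hg (eq_one_of_pow_eq_one_prime p (by omega) (by omega) this)
  · have : g ^ (k - l) = 1 := by
      have e : g ^ (k + 1) = g ^ (l + 1) * g ^ (k - l) := by rw [← pow_add]; congr 1; omega
      rw [hkl] at e
      exact (mul_eq_left.mp e.symm)
    exact hg (eq_one_of_pow_eq_one_prime p (by omega) (by omega) this)

/-- `1` is not on a punctured line of `g ≠ 1` -/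
lemma one_not_mem_pline {g : Multiplicative (ZMod p × ZMod p)} (hg : g ≠ 1) :
    (1 : Multiplicative (ZMod p × ZMod p)) ∉ (Finset.range (p - 1)).image (fun k => g ^ (k + 1)) := by
  rw [mem_pline_iff]
  rintro ⟨k, hk, h⟩
  exact hg (eq_one_of_pow_eq_one_prime p (by omega) (by omega : k + 1 < p) h.symm)

/-- an element of a punctured line generates the same punctured line... here only: it is `≠ 1` -/
lemma ne_one_of_mem_pline {g x : Multiplicative (ZMod p × ZMod p)} (hg : g ≠ 1)
    (hx : x ∈ (Finset.range (p - 1)).image (fun k => g ^ (k + 1))) : x ≠ 1 :=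
  fun h => one_not_mem_pline p hg (h ▸ hx)

/-- two punctured lines are disjoint unless the second generator lies on the first line -/
lemma disjoint_plines {g h : Multiplicative (ZMod p × ZMod p)} (hh : h ≠ 1)
    (hgh : h ∉ (Finset.range (p - 1)).image (fun k => g ^ (k + 1))) :
    Disjoint ((Finset.range (p - 1)).image (fun k => g ^ (k + 1)))
      ((Finset.range (p - 1)).image (fun k => h ^ (k + 1))) := by
  rw [Finset.disjoint_left]
  intro x hxg hxh
  rw [mem_pline_iff] at hxg hxh
  obtain ⟨k, hk, rfl⟩ := hxg
  obtain ⟨l, hl, hkl⟩ := hxh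
  have hcop : Nat.Coprime (l + 1) p :=
    Nat.Coprime.symm ((Nat.Prime.coprime_iff_not_dvd hp.out).2
      (fun hd => absurd (Nat.le_of_dvd (by omega) hd) (by omega)))
  obtain ⟨u, -, hu⟩ := Nat.exists_mul_mod_eq_one_of_coprime hcop hp.out.one_lt
  have hP : h ^ p = 1 := pair_pow_p p h
  have gP : g ^ p = 1 := pair_pow_p p g
  have hh' : h = g ^ (((k + 1) * u) % p) := by
    calc h = h ^ (((l + 1) * u) % p) := by rw [hu, pow_one]
      _ = h ^ ((l + 1) * u) := (pow_eq_pow_mod _ hP).symm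
      _ = (h ^ (l + 1)) ^ u := by rw [pow_mul]
      _ = (g ^ (k + 1)) ^ u := by rw [hkl]
      _ = g ^ ((k + 1) * u) := by rw [← pow_mul]
      _ = g ^ (((k + 1) * u) % p) := pow_eq_pow_mod _ gP
  set m := ((k + 1) * u) % p with hm
  have hmlt : m < p := Nat.mod_lt _ hp.out.pos
  rcases Nat.eq_zero_or_pos m with hm0 | hm0
  · rw [hm0, pow_zero] at hh'; exact hh hh'
  · apply hgh
    rw [mem_pline_iff]
    exact ⟨m - 1, by omega, by rw [hh']; congr 1; omega⟩

/-- **generation**: if `g ≠ 1` and `h ≠ 1` is off the line of `g`, every element of `(ℤ/p)²` is `g^a h^b`, `a, b < p` -/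
theorem exists_pow_mul_pow {g h : Multiplicative (ZMod p × ZMod p)} (hg : g ≠ 1) (hh : h ≠ 1)
    (hgh : h ∉ (Finset.range (p - 1)).image (fun k => g ^ (k + 1)))
    (x : Multiplicative (ZMod p × ZMod p)) : ∃ a b : ℕ, a < p ∧ b < p ∧ x = g ^ a * h ^ b := by
  classical
  have gP : g ^ p = 1 := pair_pow_p p g
  have hP : h ^ p = 1 := pair_pow_p p h
  -- the subgroup of products
  let K : Subgroup (Multiplicative (ZMod p × ZMod p)) :=
    { carrier := {x | ∃ a b : ℕ, a < p ∧ b < p ∧ x = g ^ a * h ^ b}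
      one_mem' := ⟨0, 0, hp.out.pos, hp.out.pos, by simp⟩
      mul_mem' := by
        rintro x y ⟨a, b, -, -, rfl⟩ ⟨c, d, -, -, rfl⟩
        refine ⟨(a + c) % p, (b + d) % p, Nat.mod_lt _ hp.out.pos, Nat.mod_lt _ hp.out.pos, ?_⟩
        rw [← pow_eq_pow_mod _ gP, ← pow_eq_pow_mod _ hP, pow_add, pow_add]
        simp only [mul_assoc, mul_left_comm (h ^ b) (g ^ c) (h ^ d)]
      inv_mem' := by
        rintro x ⟨a, b, ha, hb, rfl⟩
        refine ⟨(p - a) % p, (p - b) % p, Nat.mod_lt _ hp.out.pos, Nat.mod_lt _ hp.out.pos, ?_⟩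
        rw [← pow_eq_pow_mod _ gP, ← pow_eq_pow_mod _ hP, mul_inv, eq_comm]
        have e1 : g ^ (p - a) = (g ^ a)⁻¹ := by
          rw [eq_inv_iff_mul_eq_one, ← pow_add, show p - a + a = p by omega, gP]
        have e2 : h ^ (p - b) = (h ^ b)⁻¹ := by
          rw [eq_inv_iff_mul_eq_one, ← pow_add, show p - b + b = p by omega, hP]
        rw [e1, e2] }
  have hmemK : ∀ x, x ∈ K ↔ ∃ a b : ℕ, a < p ∧ b < p ∧ x = g ^ a * h ^ b := fun x => Iff.rfl
  -- it contains 1, the line of g and the line of h: at least 2(p-1)+1 > p elements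
  set L := insert (1 : Multiplicative (ZMod p × ZMod p))
    ((Finset.range (p - 1)).image (fun k => g ^ (k + 1)) ∪ (Finset.range (p - 1)).image (fun k => h ^ (k + 1))) with hL
  have hLcard : L.card = 2 * (p - 1) + 1 := by
    rw [hL, Finset.card_insert_of_notMem, Finset.card_union_of_disjoint (disjoint_plines p hh hgh),
      card_pline p hg, card_pline p hh]
    · ring
    · rw [Finset.mem_union, not_or]
      exact ⟨one_not_mem_pline p hg, one_not_mem_pline p hh⟩
  have hLK : ∀ x ∈ L, x ∈ K := by
    intro x hx
    rw [hL, Finset.mem_insert, Finset.mem_union, mem_pline_iff, mem_pline_iff] at hx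
    rcases hx with rfl | ⟨k, hk, rfl⟩ | ⟨k, hk, rfl⟩
    · exact K.one_mem
    · exact ⟨k + 1, 0, by omega, hp.out.pos, by simp⟩
    · exact ⟨0, k + 1, hp.out.pos, by omega, by simp⟩
  have hcardG : Nat.card (Multiplicative (ZMod p × ZMod p)) = p ^ 2 := by
    rw [Nat.card_eq_fintype_card, Fintype.card_multiplicative, Fintype.card_prod, ZMod.card, sq]
  have hdvd := Subgroup.card_subgroup_dvd_card K
  rw [hcardG] at hdvd
  obtain ⟨m, hm, hKm⟩ := (Nat.dvd_prime_pow hp.out).1 hdvd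
  have hKge : 2 * (p - 1) + 1 ≤ Nat.card K := by
    have hKc : Fintype.card K = (univ.filter fun x => x ∈ K).card :=
      Fintype.card_of_subtype _ (fun x => by simp)
    rw [Nat.card_eq_fintype_card, hKc, ← hLcard]
    apply Finset.card_le_card
    intro x hx
    simp only [Finset.mem_filter, Finset.mem_univ, true_and]
    exact hLK x hx
  have h2 : 2 ≤ p := hp.out.two_le
  have hm2 : m = 2 := by
    interval_cases m
    · rw [hKm] at hKge; simp at hKge; omega
    · rw [hKm, pow_one] at hKge; omega
    · rfl
  rw [hm2, ← hcardG] at hKm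
  have htop : K = ⊤ := (Subgroup.card_eq_iff_eq_top K).1 hKm
  have hx : x ∈ K := by rw [htop]; exact Subgroup.mem_top x
  exact (hmemK x).1 hx

/-- **consequence**: a set fixed pointwise by two independent elements is fixed by everything (general `p`) -/
theorem fixed_by_all_of_two {ι : Type*} (α β : Equiv.Perm ι) (hα : α ^ p = 1) (hβ : β ^ p = 1) (hc : Commute α β)
    (F : Finset ι) {g h : Multiplicative (ZMod p × ZMod p)} (hg : g ≠ 1) (hh : h ≠ 1)
    (hgh : h ∉ (Finset.range (p - 1)).image (fun k => g ^ (k + 1)))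
    (hFg : ∀ i ∈ F, (α ^ (Multiplicative.toAdd g).1.val * β ^ (Multiplicative.toAdd g).2.val) i = i)
    (hFh : ∀ i ∈ F, (α ^ (Multiplicative.toAdd h).1.val * β ^ (Multiplicative.toAdd h).2.val) i = i)
    (x : Multiplicative (ZMod p × ZMod p)) :
    ∀ i ∈ F, (α ^ (Multiplicative.toAdd x).1.val * β ^ (Multiplicative.toAdd x).2.val) i = i := by
  obtain ⟨a, b, -, -, rfl⟩ := exists_pow_mul_pow p hg hh hgh x
  intro i hi
  rw [pairPerm_mul p α β hα hβ hc, pairPerm_pow p α β hα hβ hc, pairPerm_pow p α β hα hβ hc, Equiv.Perm.mul_apply]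
  have hgfix : ∀ n : ℕ, ((α ^ (Multiplicative.toAdd g).1.val * β ^ (Multiplicative.toAdd g).2.val) ^ n) i = i := by
    intro n; induction n with
    | zero => simp
    | succ n ih => rw [pow_succ, Equiv.Perm.mul_apply, hFg i hi, ih]
  have hhfix : ∀ n : ℕ, ((α ^ (Multiplicative.toAdd h).1.val * β ^ (Multiplicative.toAdd h).2.val) ^ n) i = i := by
    intro n; induction n with
    | zero => simp
    | succ n ih => rw [pow_succ, Equiv.Perm.mul_apply, hFh i hi, ih]
  rw [hhfix b, hgfix a]

/-! ### line representatives and the line partition -/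


/-- every `x ≠ 1` lies on the punctured line of some standard representative -/
lemma exists_rep_mem_pline (x : Multiplicative (ZMod p × ZMod p)) (hx : x ≠ 1) :
    ∃ r ∈ insert (Multiplicative.ofAdd ((0 : ZMod p), (1 : ZMod p)))
        ((univ : Finset (ZMod p)).image (fun t => Multiplicative.ofAdd ((1 : ZMod p), t))),
      x ∈ (Finset.range (p - 1)).image (fun k => r ^ (k + 1)) := by
  haveI : NeZero p := ⟨hp.out.ne_zero⟩
  rcases hxab : Multiplicative.toAdd x with ⟨a, b⟩
  have hx' : x = Multiplicative.ofAdd (a, b) := by rw [← hxab, ofAdd_toAdd]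
  by_cases ha : a = 0
  · -- x = (0,b) = (0,1)^b
    have hb : b ≠ 0 := by
      intro hb; apply hx; rw [hx', ha, hb]; rfl
    refine ⟨Multiplicative.ofAdd ((0 : ZMod p), (1 : ZMod p)), Finset.mem_insert_self _ _, ?_⟩
    rw [mem_pline_iff]
    refine ⟨b.val - 1, ?_, ?_⟩
    · have := ZMod.val_lt b
      have : b.val ≠ 0 := fun h0 => hb ((ZMod.val_eq_zero b).1 h0)
      omega
    · have hbv : b.val - 1 + 1 = b.val := by
        have : b.val ≠ 0 := fun h0 => hb ((ZMod.val_eq_zero b).1 h0)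
        omega
      rw [hbv, ← ofAdd_nsmul, hx', ha]
      congr 1
      ext <;> simp
  · refine ⟨Multiplicative.ofAdd ((1 : ZMod p), b / a), Finset.mem_insert_of_mem
      (Finset.mem_image.mpr ⟨b / a, Finset.mem_univ _, rfl⟩), ?_⟩
    rw [mem_pline_iff]
    refine ⟨a.val - 1, ?_, ?_⟩
    · have := ZMod.val_lt a
      have : a.val ≠ 0 := fun h0 => ha ((ZMod.val_eq_zero a).1 h0)
      omega
    · have hav : a.val - 1 + 1 = a.val := by
        have : a.val ≠ 0 := fun h0 => ha ((ZMod.val_eq_zero a).1 h0)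
        omega
      rw [hav, ← ofAdd_nsmul, hx']
      congr 1
      ext
      · simp
      · show b = (a.val • ((1 : ZMod p), b / a)).2
        rw [Prod.smul_snd, nsmul_eq_mul, ZMod.natCast_zmod_val, mul_div_cancel₀ _ ha]

/-- distinct standard representatives are off each other's lines -/
lemma rep_not_mem_pline_rep {r s : Multiplicative (ZMod p × ZMod p)}
    (hr : r ∈ insert (Multiplicative.ofAdd ((0 : ZMod p), (1 : ZMod p)))
        ((univ : Finset (ZMod p)).image (fun t => Multiplicative.ofAdd ((1 : ZMod p), t))))
    (hs : s ∈ insert (Multiplicative.ofAdd ((0 : ZMod p), (1 : ZMod p)))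
        ((univ : Finset (ZMod p)).image (fun t => Multiplicative.ofAdd ((1 : ZMod p), t))))
    (hrs : r ≠ s) : s ∉ (Finset.range (p - 1)).image (fun k => r ^ (k + 1)) := by
  haveI : NeZero p := ⟨hp.out.ne_zero⟩
  rw [mem_pline_iff]
  rintro ⟨k, hk, hks⟩
  rw [← ofAdd_toAdd r, ← ofAdd_nsmul] at hks
  have hks' : Multiplicative.toAdd s = (k + 1) • Multiplicative.toAdd r := by
    rw [hks, toAdd_ofAdd]
  rw [Finset.mem_insert, Finset.mem_image] at hr hs
  -- first coordinates: reps have first coordinate 0 or 1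
  have hk1 : ((k + 1 : ℕ) : ZMod p) ≠ 0 := by
    rw [Ne, ZMod.natCast_eq_zero_iff]
    intro hd; exact absurd (Nat.le_of_dvd (by omega) hd) (by omega)
  rcases hr with rfl | ⟨t, -, rfl⟩ <;> rcases hs with rfl | ⟨t', -, rfl⟩
  · exact hrs rfl
  · have h1 := congrArg Prod.fst hks'
    simp only [toAdd_ofAdd, Prod.smul_fst] at h1
    simp at h1
  · have h1 := congrArg Prod.fst hks'
    simp only [toAdd_ofAdd, Prod.smul_fst] at h1
    simp only [nsmul_eq_mul, mul_one] at h1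
    exact hk1 h1.symm
  · have h1 := congrArg Prod.fst hks'
    have h2 := congrArg Prod.snd hks'
    simp only [toAdd_ofAdd, Prod.smul_fst, Prod.smul_snd] at h1 h2
    simp only [nsmul_eq_mul, mul_one] at h1 h2
    apply hrs
    rw [← h1, one_mul] at h2
    rw [h2]

/-- **line partition of the Burnside sum**: for `F` constant on punctured lines,
`Σ_{x ≠ 1} F x = (p − 1) · Σ_{standard reps} F r` -/
theorem sum_erase_one_eq_lines (F : Multiplicative (ZMod p × ZMod p) → ℕ)
    (hF : ∀ g, g ≠ 1 → ∀ k, k < p - 1 → F (g ^ (k + 1)) = F g) :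
    ∑ x ∈ (univ : Finset (Multiplicative (ZMod p × ZMod p))).erase 1, F x =
      (p - 1) * ∑ r ∈ insert (Multiplicative.ofAdd ((0 : ZMod p), (1 : ZMod p)))
        ((univ : Finset (ZMod p)).image (fun t => Multiplicative.ofAdd ((1 : ZMod p), t))), F r := by
  classical
  set R := insert (Multiplicative.ofAdd ((0 : ZMod p), (1 : ZMod p)))
    ((univ : Finset (ZMod p)).image (fun t => Multiplicative.ofAdd ((1 : ZMod p), t))) with hR
  have hRne : ∀ r ∈ R, r ≠ 1 := by
    intro r hr h1
    rw [hR, Finset.mem_insert, Finset.mem_image] at hr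
    rcases hr with rfl | ⟨t, -, rfl⟩
    · have := congrArg (fun x => (Multiplicative.toAdd x).2) h1
      simp at this
    · have := congrArg (fun x => (Multiplicative.toAdd x).1) h1
      simp at this
  -- univ.erase 1 = ⋃_{r ∈ R} line r (disjoint)
  have hcover : (univ : Finset (Multiplicative (ZMod p × ZMod p))).erase 1 =
      R.biUnion (fun r => (Finset.range (p - 1)).image (fun k => r ^ (k + 1))) := by
    ext x
    rw [Finset.mem_erase, Finset.mem_biUnion]
    constructor
    · rintro ⟨hx, -⟩
      exact exists_rep_mem_pline p x hx
    · rintro ⟨r, hr, hx⟩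
      exact ⟨ne_one_of_mem_pline p (hRne r hr) hx, Finset.mem_univ _⟩
  have hdisj : (R : Set (Multiplicative (ZMod p × ZMod p))).PairwiseDisjoint
      (fun r => (Finset.range (p - 1)).image (fun k => r ^ (k + 1))) := by
    intro r hr s hs hrs
    exact disjoint_plines p (hRne s hs) (rep_not_mem_pline_rep p hr hs hrs)
  rw [hcover, Finset.sum_biUnion hdisj, Finset.mul_sum]
  apply Finset.sum_congr rfl
  intro r hr
  rw [Finset.sum_image]
  · rw [Finset.sum_congr rfl (fun k hk => hF r (hRne r hr) k (Finset.mem_range.mp hk)), Finset.sum_const,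
      Finset.card_range, smul_eq_mul]
  · -- injectivity of k ↦ r^(k+1) on range (p-1)
    intro k hk l hl hkl
    by_contra hne
    simp only [Finset.coe_range, Set.mem_Iio] at hk hl
    simp only at hkl
    rcases Nat.lt_or_gt_of_ne hne with hlt | hlt
    · have : r ^ (l - k) = 1 := by
        have e : r ^ (l + 1) = r ^ (k + 1) * r ^ (l - k) := by rw [← pow_add]; congr 1; omega
        rw [← hkl] at e; exact (mul_eq_left.mp e.symm)
      exact hRne r hr (eq_one_of_pow_eq_one_prime p (by omega) (by omega) this)
    · have : r ^ (k - l) = 1 := by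
        have e : r ^ (k + 1) = r ^ (l + 1) * r ^ (k - l) := by rw [← pow_add]; congr 1; omega
        rw [hkl] at e; exact (mul_eq_left.mp e.symm)
      exact hRne r hr (eq_one_of_pow_eq_one_prime p (by omega) (by omega) this)

/-- the standard representatives are `p + 1` in number -/
lemma card_lineReps :
    (insert (Multiplicative.ofAdd ((0 : ZMod p), (1 : ZMod p)))
      ((univ : Finset (ZMod p)).image (fun t => Multiplicative.ofAdd ((1 : ZMod p), t)))).card = p + 1 := by
  rw [Finset.card_insert_of_notMem, Finset.card_image_of_injective, Finset.card_univ, ZMod.card]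
  · intro t t' h
    have := congrArg (fun x => (Multiplicative.toAdd x).2) h
    simpa using this
  · rw [Finset.mem_image]
    rintro ⟨t, -, h⟩
    have := congrArg (fun x => (Multiplicative.toAdd x).1) h
    simp at this

end lines

end Summit.Ventures.DiscreteObjects.Hadamard
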